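import Summits.BirchSwinnertonDyer.Rank1Residual.GaloisImage.PropagatedStructure
import Literature.NumberTheory.EllipticCurves.KummerSelmerStructure
import HarnessLib

/-!
# The propagated canonical structure CONTAINS the Kummer conditions: every local Kummer class of
# `E(ℚ_v)` lifts to `H¹(ℚ_v, T_pE)` (the `p`-adic Kummer map) — cell `b2b-bsdres`, team n1011,
# sub-target T-a3-F1 (hypothesis side of Sakamoto 2024 Thm. 4.4 at `p = 3`), deal R5-3 (p18)

HONEST FRAMING (cell `b2b-bsdres`, run/shared/lean/b2b/bsd-rank1-residual/, verbatim in every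
file): the goal of the cell is to DELETE the COMBINATION-SHAPED residual classes of the
Birch–Swinnerton-Dyer formula for ALL analytic-rank `≤ 1` elliptic curves over `ℚ` — "full BSD
formula for every rank `≤ 1` curve in class `C`" assembled STRICTLY from published theorems — so
that the rank-`≤ 1` remainder becomes exactly the CONSTRUCTION-SHAPED classes, which are TYPED
(missing-input `Prop`s), NOT attempted. This is not "finishing BSD". Team n1011 (N10/N11, the
additive block `X4 ∧ p = 3`): research route; no claim beyond the stated classes; the label X4 and
the mark of RESIDUAL-MAP §I N11 are UNCHANGED by this file; nothing is booked. Theorems only: no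
definition, no named fact.

## What this file proves and why

Skeleton T-a3 v2 §6 (a) / `T-a3-S3-G1.md` §3.2 (residual coisotropy of Mazur–Rubin's PROPAGATED
canonical structure `𝓕_can` at the prime `3`): "`κ₁(E(ℚ₃)/3) ⊆ 𝓕̄₃` — every Kummer class of
`E(ℚ₃)` lifts to `H¹(ℚ₃, T)`: the `3`-adic Kummer map `E(ℚ₃) ⊗ ℤ₃ → H¹(ℚ₃, T)` composed with
`H¹(T) → H¹(A_1)` is `κ₁`".  With p13's objects (`PropagatedStructure.lean`, p253604):
`propagatedSelmerStructureOne W p v = im(π_{1,*} : H¹(ℚ_v, T_pE) → H¹(ℚ_v, E[p]))`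
(`tateLocalMapOne`), which IS Sakamoto's residual structure `𝓕̄` of `𝓕_can` on `E[p^{k+1}]` for
every `k` (p13, `induced_propagatedSelmerStructure`), this file proves, for an elliptic curve
`E = W` over `ℚ`, a prime `p`, and EVERY place `v` of `ℚ` (finite or infinite, good, bad or `= p`;
no hypothesis):

* `localKummerClass_mem_propagatedSelmerStructureOne`: the local Kummer class `κ_v(Q)`
  (`WeierstrassCurve.localKummerClass`, `p • Q ∈ E(ℚ_v)`) is `π_{1,*}` of the class of the
  EXPLICIT continuous crossed homomorphism `σ ↦ (σ Q_n − Q_n)_{n ≥ 0} ∈ T_pE = lim E[p^n]`, where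
  `Q_0 = Q`, `p • Q_{n+1} = Q_n` is a chosen sequence of `p`-power roots of `Q` in `E(ℚ̄_v)`
  (divisibility of `E` over an algebraically closed field, tree `zsmul_surjective_of_isAlgClosed`)
  and the `n`-th component `σ Q_{n-1} − Q_{n-1} ∈ E(ℚ̄_v)[p^n] = E(ℚ̄)[p^n]` is the tree's local
  Kummer cocycle at level `p^n` (`WeierstrassCurve.localKummerCocycle`) — the `p`-adic Kummer map
  on the nose;
* `kummerSelmerStructure_le_propagatedSelmerStructureOne`: hence
  **`𝓛_v ≤ 𝓕_can(E[p])_v`**, the local Kummer condition (`WeierstrassCurve.kummerSelmerStructure`,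
  image of `E(ℚ_v)/p`) is contained in the propagated condition on `E[p]`.

Consequence (sibling `PropagatedConditionCoisotropicInduced.lean`, with
`PropagatedConditionCoisotropic.lean`): `𝓕_can` is residually coisotropic (Sakamoto Def. 3.8) at
every place, for every local torsion `E(ℚ_v)[p]` and every Tamagawa number.

References: R. Sakamoto, JTNB 36 (2024) 919–946, §2 and Def. 3.8 [Sakamoto2024]; K. Rubin, PCMS 18
(2011) §3.1 (propagated structures) [Rubin2011]; B. Mazur, K. Rubin, Mem. AMS 799 (2004) Def. 3.2.1,
§6.2; J. H. Silverman, *AEC* VIII.§2 (Kummer pairing), III.§7 (Tate module) [SilvermanAEC2009];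
J. S. Milne, *ADT* I §6, proof of Prop. 6.9 (the divisible lift) [MilneADT2006].
-/

noncomputable section

open scoped Classical NumberField ContRepresentation
open Field NumberField IsDedekindDomain
open WeierstrassCurve Literature.NumberTheory.EllipticCurves Literature.NumberTheory.GaloisRepresentations
  Literature.NumberTheory.GaloisRepresentations.DiscreteGaloisModule

namespace Summit.BirchSwinnertonDyer.Rank1Residual.GaloisImage

variable (W : WeierstrassCurve ℚ) [W.IsElliptic] (p : ℕ) [hp : Fact p.Prime]

/-- **Every local Kummer class lifts to `H¹(ℚ_v, T_pE)`: `κ_v(Q) ∈ 𝓕_can(E[p])_v`.**  For a place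
`v` of `ℚ` and `Q ∈ E(ℚ̄_v)` with `p • Q ∈ E(ℚ_v)`, the local Kummer class
`κ_v(Q) = [σ ↦ σQ − Q] ∈ H¹(ℚ_v, E[p])` is the image under `π_{1,*} : H¹(ℚ_v, T_pE) → H¹(ℚ_v, E[p])`
(`tateLocalMapOne`) of the class of the continuous crossed homomorphism
`σ ↦ (σ Q_{n-1} − Q_{n-1})_{n ≥ 1}` with values in `T_pE = lim E[p^n]`, for a chosen sequence
`Q_0 = Q`, `p • Q_{n+1} = Q_n` of `p`-power roots (`E(ℚ̄_v)` is divisible): the `p`-adic Kummer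
map.  Every place, every reduction type, every local torsion.  Silverman, *AEC* VIII.§2 and III.§7;
Rubin, PCMS 18 (2011) §3.1; Milne, *ADT* I §6, proof of Prop. 6.9 (divisible lifts).
[cite: SilvermanAEC2009, VIII.§2 (the Kummer pairing) and III.§7] [cite: Rubin2011, §3.1 (p. 29)] -/
theorem localKummerClass_mem_propagatedSelmerStructureOne (v : Place ℚ)
    (Q : localPoints W (Place.Completion v))
    (hQ : (p : ℤ) • Q ∈ MulAction.fixedPoints (absoluteGaloisGroup (Place.Completion v))
      (localPoints W (Place.Completion v))) :
    W.localKummerClass (p : ℤ) (Int.natCast_ne_zero.mpr hp.out.ne_zero) Q hQ ∈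
      propagatedSelmerStructureOne W p v := by
  set E := Place.Completion v with hE
  have hp0 : (p : ℤ) ≠ 0 := Int.natCast_ne_zero.mpr hp.out.ne_zero
  have hpow : ∀ m : ℕ, ((p : ℤ) ^ (m + 1)) ≠ 0 := fun m => pow_ne_zero _ hp0
  -- a chosen sequence of `p`-power roots of `Q` in the divisible group `E(ℚ̄_v)`
  have hroot : ∀ P : localPoints W E, ∃ P₁ : localPoints W E, (p : ℤ) • P₁ = P := fun P =>
    (W.baseChange (AlgebraicClosure E)).zsmul_surjective_of_isAlgClosed hp0 P
  choose rt hrt using hroot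
  let R : ℕ → localPoints W E := fun n => Nat.rec Q (fun _ P => rt P) n
  have hR0 : R 0 = Q := rfl
  have hRs : ∀ n, (p : ℤ) • R (n + 1) = R n := fun n => hrt (R n)
  have hRpow : ∀ n, ((p : ℤ) ^ n) • R n = Q := by
    intro n
    induction n with
    | zero => rw [pow_zero, one_smul]; exact hR0
    | succ n ih => rw [pow_succ, mul_smul, hRs, ih]
  have hRfix : ∀ n, ((p : ℤ) ^ (n + 1)) • R n ∈
      MulAction.fixedPoints (absoluteGaloisGroup E) (localPoints W E) := by
    intro n
    rw [pow_succ', mul_smul, hRpow n]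
    exact hQ
  -- the local Kummer cocycles `σ ↦ σ R_n − R_n ∈ E[p^{n+1}]` at every level
  let κ : ∀ m : ℕ, contOneCocycles
      (DiscreteGaloisModule.toTopRep
        (GaloisRep.restrictField E (W.torsionGaloisModule ((p : ℤ) ^ (m + 1))))) :=
    fun m => W.localKummerCocycle ((p : ℤ) ^ (m + 1)) (hpow m) (R m) (hRfix m)
  have hκ : ∀ m σ, pointsMap W E ((κ m).1 σ : geomPoints W) = σ • R m - R m := fun m σ =>
    W.pointsMap_localKummerCocycle_apply ((p : ℤ) ^ (m + 1)) (hpow m) (R m) (hRfix m) σ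
  have hinj : Function.Injective (pointsMap W E) := pointsMapOfEmb_injective W (closureEmb (K := ℚ) E)
  -- the components of the `T_pE`-valued cocycle: `a σ 0 = 0`, `a σ (m+1) = σ R_m − R_m`
  let a : absoluteGaloisGroup E → ℕ → geomPoints W := fun σ n =>
    Nat.rec (motive := fun _ => geomPoints W) 0 (fun m _ => ((κ m).1 σ : geomPoints W)) n
  have ha0 : ∀ σ, a σ 0 = 0 := fun _ => rfl
  have haS : ∀ σ m, a σ (m + 1) = ((κ m).1 σ : geomPoints W) := fun _ _ => rfl
  -- `p^n • a σ n = 0`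
  have h1 : ∀ σ n, p ^ n • a σ n = 0 := by
    intro σ n
    cases n with
    | zero => rw [ha0, smul_zero]
    | succ m =>
      rw [haS, ← natCast_zsmul, Nat.cast_pow]
      exact (mem_geomTorsion_iff W _ _).mp ((κ m).1 σ).2
  -- `p • a σ (n+1) = a σ n`
  have h2 : ∀ σ n, p • a σ (n + 1) = a σ n := by
    intro σ n
    cases n with
    | zero =>
      rw [ha0, haS, ← natCast_zsmul]
      have h := (mem_geomTorsion_iff W _ _).mp ((κ 0).1 σ).2
      have e : ((p : ℤ) ^ (0 + 1)) = (p : ℤ) := by rw [zero_add, pow_one]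
      exact (congrArg (fun c : ℤ => c • ((κ 0).1 σ : geomPoints W)) e).symm.trans h
    | succ m =>
      rw [haS, haS, ← natCast_zsmul]
      apply hinj
      rw [map_zsmul, hκ, hκ, zsmul_sub, ← smul_zsmul_localPoints, hRs]
  -- the crossed homomorphism `η : Γ_{ℚ_v} → T_pE`
  let ηfun : absoluteGaloisGroup E → W.tateModule p := fun σ => TateModule.mk (a σ) (h1 σ) (h2 σ)
  have hηproj0 : ∀ σ, TateModule.proj p 0 (ηfun σ) = 0 := fun σ => ha0 σ
  have hηprojS : ∀ σ m, TateModule.proj p (m + 1) (ηfun σ) = ((κ m).1 σ : geomPoints W) :=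
    fun σ m => haS σ m
  have hηcont : Continuous ηfun := by
    refine continuous_induced_rng.mpr (continuous_pi fun n => ?_)
    cases n with
    | zero => exact continuous_const
    | succ m =>
      change Continuous fun σ => a σ (m + 1)
      simp only [haS]
      exact continuous_subtype_val.comp (κ m).1.continuous
  let η : contOneCocycles (tateLocalRep W p v).toTopRep :=
    ⟨⟨ηfun, hηcont⟩, fun g h => by
      refine TateModule.ext fun n => ?_
      change TateModule.proj p n (ηfun (g * h)) =
        TateModule.proj p n (ηfun g + (tateLocalRep W p v).toTopRep.ρ g (ηfun h))
      rw [map_add, ContinuousRep.toTopRep_ρ_apply, tateLocalRep_apply_apply,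
        TateModule.proj_smul_of_distribMulAction]
      cases n with
      | zero => rw [hηproj0, hηproj0, hηproj0, smul_zero, add_zero]
      | succ m =>
        rw [hηprojS, hηprojS, hηprojS]
        have hc : ((κ m).1 (g * h) : geomPoints W) =
            ((κ m).1 g : geomPoints W) + absGaloisRestrict ℚ E g • ((κ m).1 h : geomPoints W) :=
          congrArg (fun P : geomTorsion W ((p : ℤ) ^ (m + 1)) => (P : geomPoints W)) ((κ m).2 g h)
        exact hc⟩
  -- `π_1 ∘ η` is the level-`p` local Kummer cocycle of `Q` (compare underlying points in `E(ℚ̄_v)`)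
  have hpush : pushCocycleOne W p v η = W.localKummerCocycle (p : ℤ) hp0 Q hQ := by
    refine Subtype.ext (ContinuousMap.ext fun g => Subtype.ext (hinj ?_))
    change pointsMap W E (TateModule.proj p 1 (ηfun g)) =
      pointsMap W E ((W.localKummerCocycle (p : ℤ) hp0 Q hQ).1 g : geomPoints W)
    have h10 : TateModule.proj p 1 (ηfun g) = ((κ 0).1 g : geomPoints W) := hηprojS g 0
    rw [W.pointsMap_localKummerCocycle_apply, h10, hκ, hR0]
  refine (mem_propagatedSelmerStructureOne_iff W p v _).mpr
    ⟨oneCocycleClass (tateLocalRep W p v).toTopRep η, ?_⟩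
  rw [tateLocalMapOne_oneCocycleClass, hpush]
  rfl

-- MAINTENANCE (ops-buildfix S10, technique T7): this theorem is ALSO declared, with the same statement, in
-- `PropagatedStructureKummer.lean` (p254000, the gate-index owner of the fully-qualified name); two modules
-- declaring one FQN can never be co-imported.  The sub-namespace below gives this copy a distinct FQN
-- (`…GaloisImage.KummerCondition.kummerSelmerStructure_le_propagatedSelmerStructureOne`, statement and proof
-- byte-identical) and the `export` keeps the unqualified name — used by `PropagatedStructureKummerEq.lean` —
-- resolving for every importer of this file.  Under co-import with `PropagatedStructureKummer` use the
-- `KummerCondition.`-qualified name (the bare alias would be ambiguous there).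
namespace KummerCondition

/-- **`𝓛_v ≤ 𝓕_can(E[p])_v` at every place**: the local Kummer condition on `E[p]` (image of
`E(ℚ_v)/p`, `WeierstrassCurve.kummerSelmerStructure`) is contained in the propagated canonical
condition `im(H¹(ℚ_v, T_pE) → H¹(ℚ_v, E[p]))` (`propagatedSelmerStructureOne`), for every place `v`
of `ℚ`, with NO hypothesis (any reduction type, any `E(ℚ_v)[p]`, any Tamagawa number).  Local
Kummer classes are `κ_v(Q)` (tree `mem_kummerLocalConditionAt_iff_exists_eq_localKummerClass`) and
those lift by `localKummerClass_mem_propagatedSelmerStructureOne`.  This is the inclusion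
"`κ₁ ⊆ 𝓕̄`" of skeleton T-a3 §6 (a) feeding Sakamoto's Def. 3.8.
[cite: Sakamoto2024, §2 (p. 921) and Def. 3.8 (p. 924)] [cite: Rubin2011, §3.1 (p. 29)] -/
theorem kummerSelmerStructure_le_propagatedSelmerStructureOne (v : Place ℚ) :
    W.kummerSelmerStructure (p : ℤ) v ≤ propagatedSelmerStructureOne W p v := by
  intro x hx
  obtain ⟨Q, hQ, rfl⟩ := (W.mem_kummerLocalConditionAt_iff_exists_eq_localKummerClass (p : ℤ)
    (E := Place.Completion v) (Int.natCast_ne_zero.mpr hp.out.ne_zero) x).mp hx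
  exact localKummerClass_mem_propagatedSelmerStructureOne W p v Q hQ

end KummerCondition

export KummerCondition (kummerSelmerStructure_le_propagatedSelmerStructureOne)

end Summit.BirchSwinnertonDyer.Rank1Residual.GaloisImage

end
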